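import Literature.Computability.Complexity.StackNumeric
import HarnessLib

/-!
# Verified arithmetic on stack programs, IV: numeric scripts and their symbolic execution

Trunk `CplxCore`, toolkit for `TimeBounds.lean`, continuing `StackNumeric.lean`. The numeric
procedure layer proves, for each procedure `nOp`, a specification
`Runs (nOp …) (base T) (base T') cost` with `T'` an explicit update of the outer register file
`T` and `cost` a polynomial in a size bound. Writing a long program directly against these lemmas
means naming every intermediate register file. This file removes that bookkeeping for the
loop-free parts of a program:

* `Com.NOp β` — the instruction set of the numeric layer as *data* (one constructor per
  procedure of `StackNumeric.lean`, plus the register utilities `clear/copy/move/const/push` and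
  a destructive bit read `popTo`), with its compilation `NOp.com`, its functional semantics
  `NOp.eval : Regs β → Regs β`, its side conditions `NOp.ok T N` (operand distinctness,
  lengths at most the size bound `N`, arithmetic preconditions) and a cost coefficient
  `NOp.cost` (the procedure runs in `cost · (N+1)³` steps);
* `Com.NS β` — *numeric scripts*: trees of instructions under sequencing and the flag test
  `ite F t e` ("pop the flag register `F`: if it held `[true]` run `t`, if it was empty run
  `e`"), with `com`, `eval`, `ok`, `cost` extended structurally;
* `Com.NS.runs` — **symbolic execution is sound**: if `s.ok T N` then
  `Runs s.com (base T) (base (s.eval T)) (s.cost · (N+1)³)`.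
* `Regs.sets T l` — register files written as a base file updated along an association list,
  the normal form of the update chains produced by `eval` (`Regs.update_eq_sets`,
  `Regs.update_sets`, `Regs.sets_sets`), compared entrywise on the registers mentioned
  (`Regs.sets_ext`) rather than register by register.

For a concrete script, `simp` unfolds `ok` into the list of arithmetic side conditions along the
symbolic run and `eval` into the final register file, so a straight-line fragment of any length
is verified by discharging its side conditions and comparing one final state.

**Relation to sibling files.** `StackStrings.lean` has the non-destructive flag test
`Com.ifFlag` (it re-pushes the flag) with `runs_ifFlag`; `NS.ite` here is the destructive
variant (the flag is popped, which is what the scripts want: flags are single-use scratch) and,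
more to the point, is a constructor of a *data type* of scripts carrying `eval`/`ok`/`cost`, so
that a whole fragment is verified by one `simp`-driven symbolic execution (`NS.runs_of_eq`)
rather than by chaining one `Runs` lemma per instruction. `StackBricks.lean` packages single
routines as `FP` string functions (`Brick.unOp_mem_FP`); scripts instead compose *inside* one
large program whose `FP` membership is established once (`Com.mem_FP`).

## References

* T. Nipkow, G. Klein, *Concrete Semantics with Isabelle/HOL*, Springer 2014, §7.2 (big-step
  execution of loop-free programs is a function of the initial state), Ch. 12–13 (verification
  conditions by symbolic execution).
* D. E. Knuth, *The Art of Computer Programming*, Vol. 2, 3rd ed., 1998, §4.3.1, §4.6.3 (the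
  procedures scripted here). (Folklore material, fully proved here.)
-/

namespace Literature.Computability.Complexity

open _root_.Computability

/-- A set flag is `[true]`. [folklore] -/
@[simp] theorem flag_eq_true_iff (c : Bool) : flag c = [true] ↔ c = true := by cases c <;> simp

/-- A cleared flag is `[]`. [folklore] -/
@[simp] theorem flag_eq_nil_iff (c : Bool) : flag c = [] ↔ c = false := by cases c <;> simp

/-! ### Register files as association lists over a base file -/

namespace Regs

variable {ι : Type} [DecidableEq ι]

/-- `T.sets l`: the register file `T` updated at the entries of the association list `l`, earlier
entries taking precedence — a normal form for the chains of `Function.update` produced by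
symbolic execution, compared entrywise by `Regs.sets_ext`. [folklore] -/
def sets (T : Regs ι) : List (ι × List Bool) → Regs ι
  | [] => T
  | (a, v) :: l => Function.update (T.sets l) a v

/-- No entries. [folklore] -/
@[simp] theorem sets_nil (T : Regs ι) : T.sets [] = T := rfl

/-- One more entry is one more update. [folklore] -/
theorem sets_cons (T : Regs ι) (a : ι) (v : List Bool) (l : List (ι × List Bool)) :
    T.sets ((a, v) :: l) = Function.update (T.sets l) a v := rfl

/-- Reading the first entry. [folklore] -/
@[simp] theorem sets_cons_self (T : Regs ι) (a : ι) (v : List Bool) (l : List (ι × List Bool)) :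
    T.sets ((a, v) :: l) a = v := by
  simp [sets_cons]

/-- Reading past the first entry. [folklore] -/
@[simp] theorem sets_cons_of_ne (T : Regs ι) {a r : ι} (v : List Bool) (l : List (ι × List Bool)) (h : r ≠ a) :
    T.sets ((a, v) :: l) r = T.sets l r := by
  simp [sets_cons, h]

/-- An update of a base file is a one-entry list. [folklore] -/
theorem update_eq_sets (T : Regs ι) (a : ι) (v : List Bool) : Function.update T a v = T.sets [(a, v)] := rfl

/-- An update of a list of entries is one more entry. [folklore] -/
theorem update_sets (T : Regs ι) (l : List (ι × List Bool)) (a : ι) (v : List Bool) :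
    Function.update (T.sets l) a v = T.sets ((a, v) :: l) := rfl

/-- Nested entry lists concatenate. [folklore] -/
@[simp] theorem sets_sets (T : Regs ι) (l₁ l₂ : List (ι × List Bool)) : (T.sets l₁).sets l₂ = T.sets (l₂ ++ l₁) := by
  induction l₂ with
  | nil => rfl
  | cons e l₂ ih => obtain ⟨a, v⟩ := e; simp [sets_cons, ih]

/-- Registers not mentioned keep their base contents. [folklore] -/
theorem sets_apply_of_not_mem (T : Regs ι) {l : List (ι × List Bool)} {r : ι} (h : r ∉ l.map Prod.fst) :
    T.sets l r = T r := by
  induction l with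
  | nil => rfl
  | cons e l ih =>
    obtain ⟨a, v⟩ := e
    simp only [List.map_cons, List.mem_cons, not_or] at h
    rw [sets_cons_of_ne _ _ _ h.1, ih h.2]

/-- **Entrywise comparison**: two entry lists over the same base file give the same register
file as soon as they agree on every register mentioned in either list. [folklore] -/
theorem sets_ext {T : Regs ι} {l₁ l₂ : List (ι × List Bool)}
    (h : ∀ r ∈ l₁.map Prod.fst ++ l₂.map Prod.fst, T.sets l₁ r = T.sets l₂ r) : T.sets l₁ = T.sets l₂ := by
  funext r
  by_cases hr : r ∈ l₁.map Prod.fst ++ l₂.map Prod.fst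
  · exact h r hr
  · rw [List.mem_append, not_or] at hr
    rw [sets_apply_of_not_mem T hr.1, sets_apply_of_not_mem T hr.2]

end Regs

namespace Com

variable {β : Type}

/-! ### Cost bookkeeping in units of `(N+1)³` -/

/-- `(N+1)³ ≥ 1`. [folklore] -/
theorem one_le_cube (N : ℕ) : 1 ≤ (N + 1) ^ 3 := Nat.one_le_pow _ _ (Nat.succ_pos N)

/-- `N + 1 ≤ (N+1)³`. [folklore] -/
theorem succ_le_cube (N : ℕ) : N + 1 ≤ (N + 1) ^ 3 := by
  calc N + 1 = (N + 1) ^ 1 := (pow_one _).symm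
    _ ≤ (N + 1) ^ 3 := Nat.pow_le_pow_right (Nat.succ_pos N) (by norm_num)

/-- `(N+1)² ≤ (N+1)³`. [folklore] -/
theorem sq_le_cube (N : ℕ) : (N + 1) ^ 2 ≤ (N + 1) ^ 3 :=
  Nat.pow_le_pow_right (Nat.succ_pos N) (by norm_num)

/-- Linear costs in units of `(N+1)³`: `a N + b ≤ (a + b)(N+1)³`. [folklore] -/
theorem lin_le_cube (a b N : ℕ) : a * N + b ≤ (a + b) * (N + 1) ^ 3 := by
  have h := succ_le_cube N
  calc a * N + b ≤ (a + b) * (N + 1) := by nlinarith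
    _ ≤ (a + b) * (N + 1) ^ 3 := Nat.mul_le_mul_left _ h

/-- Costs `c (N+1)` in units of `(N+1)³`. [folklore] -/
theorem lin1_le_cube (c N : ℕ) : c * (N + 1) ≤ c * (N + 1) ^ 3 := Nat.mul_le_mul_left _ (succ_le_cube N)

/-- Costs `c (N+1)²` in units of `(N+1)³`. [folklore] -/
theorem sq_le_cube' (c N : ℕ) : c * (N + 1) ^ 2 ≤ c * (N + 1) ^ 3 := Nat.mul_le_mul_left _ (sq_le_cube N)

/-! ### The instruction set -/

/-- The instructions of numeric scripts, operands in the outer bank `β`: register utilities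
(`clear`, `copy src dst` = put a copy of `src` on top of `dst`, `move`, `const`, `push`, the bit
read `popTo src dst` = pop the first bit of `src` onto `dst`, reading `false` if `src` is empty,
`drop r` = discard the first bit of `r`, `pour src dst` = empty `src` onto `dst`, reversed),
and the procedures of `StackNumeric.lean` (`nrm` = `nNorm`, `add`, `sub`, `succ`, `mul`,
`divMod`, `cmp`, `eq`, `isT`, `not`, `mulMod`, `powMod`, `unpair`, `pairOnto`, `toUnary`, `len`).
[Knuth 1998, §4.3.1; folklore] [folklore] -/
inductive NOp (β : Type) where
  | clear (r : β)
  | copy (src dst : β)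
  | move (src dst : β)
  | const (r : β) (w : List Bool)
  | push (r : β) (b : Bool)
  | popTo (src dst : β)
  | drop (r : β)
  | pour (src dst : β)
  | nrm (r : β)
  | add (dst a b : β)
  | sub (dst a b : β)
  | succ (dst src : β)
  | mul (dst a b : β)
  | divMod (qd rd a b : β)
  | cmp (F a b : β)
  | eq (F a b G : β)
  | isT (r F : β)
  | not (F : β)
  | mulMod (dst src m : β)
  | powMod (dst b e m : β)
  | unpair (src fst snd : β)
  | pairOnto (src dst : β)
  | toUnary (dst src : β)
  | len (dst src tmp : β)

namespace NOp

/-- Compilation of an instruction to a stack program over `EReg ⊕ β`. [folklore] -/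
def com : NOp β → Com (EReg ⊕ β)
  | clear r => Com.clear (Sum.inr r)
  | copy s d => Com.copy (Sum.inr s) (Sum.inr d) (ra .t) (ra .u)
  | move s d => Com.move (Sum.inr s) (Sum.inr d) (ra .s)
  | const r w => setConst (Sum.inr r) w
  | push r b => Com.push (Sum.inr r) b
  | popTo s d => Com.pop (Sum.inr s) (Com.push (Sum.inr d) true) (Com.push (Sum.inr d) false)
      (Com.push (Sum.inr d) false)
  | drop r => Com.pop (Sum.inr r) skip skip skip
  | pour s d => Com.pour (Sum.inr s) (Sum.inr d)
  | nrm r => nNorm r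
  | add d a b => nAdd d a b
  | sub d a b => nSub d a b
  | succ d s => nSucc d s
  | mul d a b => nMul d a b
  | divMod q r a b => nDivMod q r a b
  | cmp F a b => nCmp F a b
  | eq F a b G => nEq F a b G
  | isT r F => nIsT r F
  | not F => nNot F
  | mulMod d s m => nModMul d s m
  | powMod d b e m => nPowMod d b e m
  | unpair s f sn => nUnpair s f sn
  | pairOnto s d => nPairOnto s d
  | toUnary d s => nToUnary d s
  | len d s t => nLen d s t

variable [DecidableEq β]

/-- The functional semantics of an instruction on the outer register file (the final states of
the simulation lemmas of `StackNumeric.lean`). [folklore] -/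
@[simp] def eval : NOp β → Regs β → Regs β
  | clear r, T => Function.update T r []
  | copy s d, T => Function.update T d (T s ++ T d)
  | move s d, T => Function.update (Function.update T s []) d (T s ++ T d)
  | const r w, T => Function.update T r w
  | push r b, T => Function.update T r (b :: T r)
  | popTo s d, T => Function.update (Function.update T s (T s).tail) d ((T s).headD false :: T d)
  | drop r, T => Function.update T r (T r).tail
  | pour s d, T => Function.update (Function.update T s []) d ((T s).reverse ++ T d)
  | nrm r, T => Function.update T r (Literature.Computability.Complexity.norm (T r))
  | add d a b, T => Function.update T d (encodeNat (bitsToNat (T a) + bitsToNat (T b)))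
  | sub d a b, T => Function.update T d (encodeNat (bitsToNat (T a) - bitsToNat (T b)))
  | succ d s, T => Function.update T d (encodeNat (bitsToNat (T s) + 1))
  | mul d a b, T => Function.update T d (encodeNat (bitsToNat (T a) * bitsToNat (T b)))
  | divMod q r a b, T => Function.update (Function.update T q (encodeNat (bitsToNat (T a) / bitsToNat (T b)))) r
      (encodeNat (bitsToNat (T a) % bitsToNat (T b)))
  | cmp F a b, T => Function.update T F (flag (decide (bitsToNat (T b) ≤ bitsToNat (T a))))
  | eq F a b _, T => Function.update T F (flag (decide (bitsToNat (T a) = bitsToNat (T b))))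
  | isT r F, T => Function.update (Function.update T r []) F (flag (decide (T r = [true])))
  | not F, T => Function.update T F (flag (decide (T F = [])))
  | mulMod d s m, T => Function.update T d (encodeNat (bitsToNat (T d) * bitsToNat (T s) % bitsToNat (T m)))
  | powMod d b e m, T => Function.update T d (encodeNat (bitsToNat (T b) ^ bitsToNat (T e) % bitsToNat (T m)))
  | unpair s f sn, T => Function.update (Function.update (Function.update T s []) f (boolUnpair (T s)).1) sn
      (boolUnpair (T s)).2
  | pairOnto s d, T => Function.update (Function.update T s []) d (boolPair (T s) (T d))
  | toUnary d s, T => Function.update T d (List.replicate (bitsToNat (T s)) true)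
  | len d s _, T => Function.update T d (encodeNat (T s).length)

/-- The side conditions of an instruction on a register file, relative to the size bound `N`:
distinctness of operands, operand lengths at most `N` (results may be one bit or a factor
longer, as the procedures allow), and the arithmetic preconditions (no borrow, nonzero divisor,
modulus `> 1`, flags well-formed). [folklore] -/
@[simp] def ok : NOp β → Regs β → ℕ → Prop
  | clear r, T, N => (T r).length ≤ N
  | copy s d, T, N => s ≠ d ∧ (T s).length ≤ N
  | move s d, T, N => s ≠ d ∧ (T s).length ≤ N
  | const r w, T, N => (T r).length ≤ N ∧ w.length ≤ N
  | push _ _, _, _ => True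
  | popTo s d, _, _ => s ≠ d
  | drop _, _, _ => True
  | pour s d, T, N => s ≠ d ∧ (T s).length ≤ N
  | nrm r, T, N => (T r).length ≤ N
  | add d a b, T, N => (T a).length ≤ N ∧ (T b).length ≤ N ∧ (T d).length ≤ N + 1
  | sub d a b, T, N => (T a).length ≤ N ∧ (T b).length ≤ N ∧ (T d).length ≤ N + 1 ∧
      bitsToNat (T b) ≤ bitsToNat (T a)
  | succ d s, T, N => (T s).length ≤ N ∧ (T d).length ≤ N + 1
  | mul d a b, T, N => (T a).length ≤ N ∧ (T b).length ≤ N ∧ (T d).length ≤ 2 * N + 2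
  | divMod q r a b, T, N => q ≠ r ∧ q ≠ a ∧ q ≠ b ∧ r ≠ a ∧ r ≠ b ∧ (T a).length ≤ N ∧
      (T b).length ≤ N ∧ (T q).length ≤ N ∧ (T r).length ≤ N ∧ 0 < bitsToNat (T b)
  | cmp F a b, T, N => (T a).length ≤ N ∧ (T b).length ≤ N ∧ T F = []
  | eq F a b G, T, N => F ≠ G ∧ F ≠ a ∧ F ≠ b ∧ (T a).length ≤ N ∧ (T b).length ≤ N ∧
      T F = [] ∧ T G = []
  | isT r F, T, N => r ≠ F ∧ T F = [] ∧ (T r).length ≤ N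
  | not F, T, _ => T F = [] ∨ T F = [true]
  | mulMod d s m, T, N => d ≠ s ∧ d ≠ m ∧ (T d).length ≤ N ∧ (T s).length ≤ N ∧
      (T m).length ≤ N ∧ 0 < bitsToNat (T m)
  | powMod d b e m, T, N => d ≠ b ∧ d ≠ e ∧ d ≠ m ∧ (T d).length ≤ N ∧ (T b).length ≤ N ∧
      (T e).length ≤ N ∧ (T m).length ≤ N ∧ 1 < bitsToNat (T m)
  | unpair s f sn, T, N => s ≠ f ∧ s ≠ sn ∧ f ≠ sn ∧ T f = [] ∧ T sn = [] ∧ (T s).length ≤ N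
  | pairOnto s d, T, N => s ≠ d ∧ (T s).length ≤ N
  | toUnary d s, T, N => T d = [] ∧ (T s).length ≤ N ∧ bitsToNat (T s) ≤ N
  | len d s t, T, N => d ≠ s ∧ d ≠ t ∧ s ≠ t ∧ (T s).length ≤ N ∧ (T d).length ≤ N ∧ T t = []

/-- The cost coefficient of an instruction: it runs in at most `cost · (N+1)³` steps under
`ok T N` (from the step counts of `StackNumeric.lean`). [folklore] -/
@[simp] def cost : NOp β → ℕ
  | clear _ => 3
  | copy _ _ => 13
  | move _ _ => 8
  | const _ _ => 4
  | push _ _ => 1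
  | popTo _ _ => 3
  | drop _ => 2
  | pour _ _ => 4
  | nrm _ => 30
  | add _ _ _ => 65
  | sub _ _ _ => 71
  | succ _ _ => 72
  | mul _ _ _ => 270
  | divMod _ _ _ _ => 350
  | cmp _ _ _ => 56
  | eq _ _ _ _ => 117
  | isT _ _ => 7
  | not _ => 4
  | mulMod _ _ _ => 940
  | powMod _ _ _ _ => 1900
  | unpair _ _ _ => 16
  | pairOnto _ _ => 12
  | toUnary _ _ => 42
  | len _ _ _ => 90

/-- The bit read: `popTo s d` pops the first bit of `s` (or reads `false` if `s` is empty) onto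
`d`, in `3` steps. [folklore] -/
theorem runs_popTo {s d : β} (hsd : s ≠ d) (T : Regs β) :
    Runs (popTo s d).com (base T) (base ((popTo s d).eval T)) 3 := by
  unfold com
  rcases hs : T s with _ | ⟨b, w⟩
  · have e1 : Function.update T s [] = T := Function.update_eq_self_iff.2 hs.symm
    have e : (popTo s d).eval T = Function.update T d (false :: T d) := by
      simp only [eval, hs, List.tail_nil, List.headD_nil, e1]
    rw [e]
    exact (Runs.opop_nil _ _ hs (Runs.opush d false T)).of_eq rfl (by norm_num)
  · have e : (popTo s d).eval T = Function.update (Function.update T s w) d (b :: T d) := by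
      simp only [eval, hs, List.tail_cons, List.headD_cons]
    rw [e]
    cases b
    · refine (Runs.opop_false _ _ hs (Runs.opush d false _)).of_eq ?_ (by norm_num)
      simp [Function.update_of_ne hsd.symm]
    · refine (Runs.opop_true _ _ hs (Runs.opush d true _)).of_eq ?_ (by norm_num)
      simp [Function.update_of_ne hsd.symm]

/-- The bit discard: `drop r` removes the first bit of `r` (if any), in `2` steps. [folklore] -/
theorem runs_drop (r : β) (T : Regs β) : Runs (drop r).com (base T) (base ((drop r).eval T)) 2 := by
  unfold com
  rcases hr : T r with _ | ⟨b, w⟩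
  · have e1 : Function.update T r [] = T := Function.update_eq_self_iff.2 hr.symm
    have e : (drop r).eval T = T := by simp only [eval, hr, List.tail_nil, e1]
    rw [e]
    exact (Runs.opop_nil _ _ hr (Runs.skip _)).of_eq rfl (by norm_num)
  · have e : (drop r).eval T = Function.update T r w := by simp only [eval, hr, List.tail_cons]
    rw [e]
    cases b
    · exact (Runs.opop_false _ _ hr (Runs.skip _)).of_eq rfl (by norm_num)
    · exact (Runs.opop_true _ _ hr (Runs.skip _)).of_eq rfl (by norm_num)

/-- **Soundness of one instruction**: under its side conditions, an instruction runs from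
`base T` to `base (eval T)` within `cost · (N+1)³` steps. [Knuth 1998, §4.3.1, §4.6.3;
folklore] [folklore] -/
theorem runs : ∀ (o : NOp β) (T : Regs β) {N : ℕ}, o.ok T N →
    Runs o.com (base T) (base (o.eval T)) (o.cost * (N + 1) ^ 3)
  | clear r, T, N, h => by
    refine (runs_oclear r T).of_eq rfl ?_
    have := lin_le_cube 2 1 N; simp only [ok] at h; simp only [cost]; nlinarith
  | copy s d, T, N, h => by
    obtain ⟨hsd, hl⟩ := h
    refine (runs_ocopy hsd T).of_eq rfl ?_
    have := lin_le_cube 10 3 N; simp only [cost]; nlinarith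
  | move s d, T, N, h => by
    obtain ⟨hsd, hl⟩ := h
    refine (runs_omove hsd T).of_eq rfl ?_
    have := lin_le_cube 6 2 N; simp only [cost]; nlinarith
  | const r w, T, N, h => by
    obtain ⟨hr, hw⟩ := h
    refine (runs_setConst (Sum.inr r : EReg ⊕ β) w (base T)).of_eq (by simp) ?_
    have := lin_le_cube 3 1 N; simp only [nst_inr, cost]; nlinarith
  | push r b, T, N, _ => (Runs.opush r b T).of_eq rfl (by simp [one_le_cube])
  | popTo s d, T, N, h => (runs_popTo h T).of_eq rfl (by have := one_le_cube N; simp only [cost]; nlinarith)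
  | drop r, T, N, _ => (runs_drop r T).of_eq rfl (by have := one_le_cube N; simp only [cost]; nlinarith)
  | pour s d, T, N, h => by
    obtain ⟨hsd, hl⟩ := h
    refine (runs_opour hsd T).of_eq rfl ?_
    have := lin_le_cube 3 1 N; simp only [cost]; nlinarith
  | nrm r, T, N, h => by
    refine (runs_nNorm r T).of_eq rfl ?_
    have := lin_le_cube 21 9 N; simp only [ok] at h; simp only [cost]; nlinarith
  | add d a b, T, N, h => by
    obtain ⟨ha, hb, hd⟩ := h
    exact (runs_nAdd d a b T ha hb hd).of_eq rfl (lin1_le_cube 65 N)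
  | sub d a b, T, N, h => by
    obtain ⟨ha, hb, hd, hle⟩ := h
    exact (runs_nSub d a b T ha hb hd hle).of_eq rfl (lin1_le_cube 71 N)
  | succ d s, T, N, h => by
    obtain ⟨hs, hd⟩ := h
    exact (runs_nSucc d s T hs hd).of_eq rfl (lin1_le_cube 72 N)
  | mul d a b, T, N, h => by
    obtain ⟨ha, hb, hd⟩ := h
    exact (runs_nMul d a b T ha hb hd).of_eq rfl (sq_le_cube' 270 N)
  | divMod q r a b, T, N, h => by
    obtain ⟨hqr, hqa, hqb, hra, hrb, ha, hb, hq, hr, hpos⟩ := h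
    exact (runs_nDivMod hqr hqa hqb hra hrb T ha hb hq hr hpos).of_eq rfl (sq_le_cube' 350 N)
  | cmp F a b, T, N, h => by
    obtain ⟨ha, hb, hF⟩ := h
    exact (runs_nCmp F a b T ha hb hF).of_eq rfl (lin1_le_cube 56 N)
  | eq F a b G, T, N, h => by
    obtain ⟨hFG, hFa, hFb, ha, hb, hF, hG⟩ := h
    exact (runs_nEq hFG hFa hFb T ha hb hF hG).of_eq rfl (lin1_le_cube 117 N)
  | isT r F, T, N, h => by
    obtain ⟨hrF, hF, hr⟩ := h
    refine (runs_nIsT hrF T hF).of_eq rfl ?_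
    have := lin_le_cube 2 5 N; simp only [cost]; nlinarith
  | not F, T, N, h => by
    rcases h with hF | hF
    · refine (runs_nNot F T false (by simpa using hF)).of_eq (by simp [hF]) ?_
      have := one_le_cube N; simp only [cost]; nlinarith
    · refine (runs_nNot F T true (by simpa using hF)).of_eq (by simp [hF]) ?_
      have := one_le_cube N; simp only [cost]; nlinarith
  | mulMod d s m, T, N, h => by
    obtain ⟨hds, hdm, hd, hs, hm, hpos⟩ := h
    exact (runs_nModMul hds hdm T hd hs hm hpos).of_eq rfl (sq_le_cube' 940 N)
  | powMod d b e m, T, N, h => by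
    obtain ⟨hdb, hde, hdm, hd, hb, he, hm, hm1⟩ := h
    exact (runs_nPowMod hdb hde hdm T hd hb he hm hm1).of_eq rfl le_rfl
  | unpair s f sn, T, N, h => by
    obtain ⟨hsf, hss, hfs, hf, hsn, hs⟩ := h
    refine (runs_nUnpair hsf hss hfs T hf hsn).of_eq rfl ?_
    have := lin_le_cube 9 7 N; simp only [cost]; nlinarith
  | pairOnto s d, T, N, h => by
    obtain ⟨hsd, hs⟩ := h
    refine (runs_nPairOnto hsd T).of_eq rfl ?_
    have := lin_le_cube 8 4 N; simp only [cost]; nlinarith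
  | toUnary d s, T, N, h => by
    obtain ⟨hd, hs, hv⟩ := h
    refine (runs_nToUnary d s T hd).of_eq rfl ?_
    simp only [cost]
    have h1 : (T s).length * (16 * bitsToNat (T s) + 21) + 5 ≤ N * (16 * N + 21) + 5 :=
      Nat.add_le_add_right (Nat.mul_le_mul hs (by omega)) _
    have h2 : N * (16 * N + 21) + 5 ≤ 42 * (N + 1) ^ 2 := by nlinarith
    exact h1.trans (h2.trans (sq_le_cube' 42 N))
  | len d s t, T, N, h => by
    obtain ⟨hds, hdt, hst, hs, hd, ht⟩ := h
    exact (runs_nLen hds hdt hst T hs hd ht).of_eq rfl (sq_le_cube' 90 N)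

end NOp

/-! ### Scripts -/

/-- Numeric scripts: instructions under sequencing and the flag test `ite F t e` — pop the flag
register `F`; if it held `[true]` continue with `t` (the flag now cleared), if it was empty
continue with `e`. [Nipkow–Klein 2014, §7.1; folklore] [folklore] -/
inductive NS (β : Type) where
  | op (o : NOp β)
  | seq (s₁ s₂ : NS β)
  | ite (F : β) (t e : NS β)
  | nop

namespace NS

/-- The script of a list of instructions. [folklore] -/
@[simp] def ofList : List (NOp β) → NS β
  | [] => nop
  | o :: l => seq (op o) (ofList l)

/-- Compilation of a script (`ite` becomes a `pop` on the flag register). [folklore] -/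
def com : NS β → Com (EReg ⊕ β)
  | op o => o.com
  | seq s₁ s₂ => s₁.com ;; s₂.com
  | ite F t e => Com.pop (Sum.inr F) t.com e.com e.com
  | nop => skip

variable [DecidableEq β]

/-- Symbolic execution: the final outer register file. [Nipkow–Klein 2014, §7.2] [folklore] -/
@[simp] def eval : NS β → Regs β → Regs β
  | op o, T => o.eval T
  | seq s₁ s₂, T => s₂.eval (s₁.eval T)
  | ite F t e, T => if T F = [true] then t.eval (Function.update T F []) else e.eval T
  | nop, T => T

/-- The side conditions along the symbolic run (at an `ite` the flag register must hold a flag,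
and only the branch taken is constrained). [Nipkow–Klein 2014, Ch. 12; folklore] [folklore] -/
@[simp] def ok : NS β → Regs β → ℕ → Prop
  | op o, T, N => o.ok T N
  | seq s₁ s₂, T, N => s₁.ok T N ∧ s₂.ok (s₁.eval T) N
  | ite F t e, T, N => (T F = [true] ∧ t.ok (Function.update T F []) N) ∨ (T F = [] ∧ e.ok T N)
  | nop, _, _ => True

/-- The cost coefficient of a script (worst branch at an `ite`, plus the test). [folklore] -/
@[simp] def cost : NS β → ℕ
  | op o => o.cost
  | seq s₁ s₂ => s₁.cost + s₂.cost
  | ite _ t e => 2 + max t.cost e.cost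
  | nop => 0

/-- **Soundness of symbolic execution.** Under its side conditions a script runs from `base T`
to `base (s.eval T)` within `s.cost · (N+1)³` steps. [Nipkow–Klein 2014, §7.2 with Ch. 12;
folklore] [folklore] -/
theorem runs {N : ℕ} : ∀ (s : NS β) (T : Regs β), s.ok T N →
    Runs s.com (base T) (base (s.eval T)) (s.cost * (N + 1) ^ 3)
  | op o, T, h => o.runs T h
  | seq s₁ s₂, T, h => by
    obtain ⟨h₁, h₂⟩ := h
    exact ((runs s₁ T h₁).seq (runs s₂ _ h₂)).of_eq rfl (by simp [Nat.add_mul])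
  | ite F t e, T, h => by
    have hX := one_le_cube N
    rcases h with ⟨hF, h⟩ | ⟨hF, h⟩
    · refine (Runs.opop_true (k := F) (w := []) e.com e.com hF (runs t _ h)).of_eq (by simp [hF]) ?_
      simp only [cost]
      have : t.cost ≤ max t.cost e.cost := le_max_left _ _
      nlinarith
    · refine (Runs.opop_nil t.com e.com hF (runs e _ h)).of_eq (by simp [hF]) ?_
      simp only [cost]
      have : e.cost ≤ max t.cost e.cost := le_max_right _ _
      nlinarith
  | nop, T, _ => (Runs.skip _).of_eq rfl (Nat.zero_le _)

/-- Soundness, repackaged with a target state and budget. [folklore] -/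
theorem runs_of_eq {N : ℕ} (s : NS β) (T : Regs β) (h : s.ok T N) {T' : Regs β} {B : ℕ}
    (hT : s.eval T = T') (hB : s.cost * (N + 1) ^ 3 ≤ B) : Runs s.com (base T) (base T') B :=
  (runs s T h).of_eq (by rw [hT]) hB

end NS

end Com

end Literature.Computability.Complexity
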